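import Summits.BirchSwinnertonDyer.BirchSwinnertonDyer.Theorems.EisensteinPrimesMazurMCOnX1RankZeroMudescent

/-!
# Sketch — crux idea `horocycle-generation` (bsd-eis-idea g11) for
`EisensteinPrimes.MazurMCOnX1RankZero` (stmt-BirchSwinnertonDyer-19035)

Typed candidate statements (card stage: they must elaborate; nothing is proved here except the
composition to the crux BY NAME through the landed μ/λ door
`EisensteinPrimesMazurMCOnX1RankZeroMudescent.mazurMCOnX1RankZero_of_analyticMuZero_offLocus_of_lambdaCount_offLocus`).

* `UnitBall W p`            — some ball of the `ω⁰`-branch Mazur–Swinnerton-Dyer measure of `W`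
                              (Néron-normalised) has mass of norm `> p⁻¹`.
* `HorocycleNonConstancy W p` — the Néron-normalised plus modular symbol of `W`, summed over the
                              Teichmüller fibre, is NOT constant (mod `p`) along the `p`-power
                              horocycle `{x/p^N : x ∈ (ℤ/p^N)ˣ}` for some level `N` ("the first
                              non-congruence layer separates p-power horocycle loops").
* `HorocycleCongruenceCriterion N p` — (HC) the group-theoretic transfer `C⁺`: a `p`-power-order
                              character of `Γ₀(N)` killing all non-hyperbolic elements which is
                              constant on every horocycle `D_n = {γ : d(γ) = p^n}` factors through
                              `γ ↦ d(γ) mod N` (is of Shimura type).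
-/

open scoped MatrixGroups ModularForm
open CongruenceSubgroup WeierstrassCurve
open Literature.NumberTheory.EllipticCurves Literature.NumberTheory.EllipticCurves.ModularForms
open Literature.NumberTheory.EllipticCurves.Rank1Residual
open Literature.Barriers.BirchSwinnertonDyer (HasRamifiedOddLineAt)
open Summit.BirchSwinnertonDyer.Rank1Residual
open Summit.BirchSwinnertonDyer.BirchSwinnertonDyer.Theses
open Summit.BirchSwinnertonDyer.BirchSwinnertonDyer.Theorems

namespace Summit.BirchSwinnertonDyer.BirchSwinnertonDyer.Cruxes.MazurMCOnX1RankZero.HorocycleGeneration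

/-- The Teichmüller-averaged level-`N` point `η γ^s mod p^N` (`N = n + e₀`), as in
`padicLRiemannSum`. -/
noncomputable def horoPoint (p : ℕ) [Fact p.Prime] (n : ℕ)
    (w : rootsOfUnity (torsionOrder p) ℤ_[p]) (s : ZMod (p ^ n)) :
    ZMod (p ^ (n + cyclotomicExponent p)) :=
  PadicInt.toZModPow (n + cyclotomicExponent p) ((w : ℤ_[p]ˣ) : ℤ_[p]) *
    (cyclotomicGenerator p : ZMod (p ^ (n + cyclotomicExponent p))) ^ s.val

/-- `UnitBall W p`: for the newform `f` of `W` and the Néron normalisation `ϖ = Ω⁺_f/Ω_W`, some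
ball `γ^s (1 + p^{n+e₀} ℤ_p)` of the `ω⁰`-branch MSD measure has mass of norm `> p⁻¹`
(i.e. the branch measure is nonzero mod `p`: `μ(M⁰_W) = 0` in measure form). -/
def UnitBall (W : WeierstrassCurve ℚ) [W.IsElliptic] [W.IsGloballyMinimal]
    (p : ℕ) [Fact p.Prime] : Prop :=
  ∀ [NeZero (W.conductorNorm ℤ)] (f : CuspForm (Gamma0 (W.conductorNorm ℤ)) 2),
    IsNewformOf W f → ∀ (ϖ : ℚ), (ϖ : ℝ) * W.realPeriodRat = plusPeriod f →
    ∃ (n : ℕ) (s : ZMod (p ^ n)),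
      (p : ℝ) ^ (-(1 : ℤ)) <
        ‖(ϖ : ℚ_[p]) * ∑ᶠ w : rootsOfUnity (torsionOrder p) ℤ_[p],
            msdMeasure f (unitRoot W p : ℚ_[p]) (n + cyclotomicExponent p) (horoPoint p n w s)‖

/-- The Teichmüller-averaged, Néron-normalised plus modular symbol at the level-`(n+e₀)` horocycle
point indexed by `s`: `ϖ · ∑_η [ (η γ^s mod p^N) / p^N ]⁺_f`, `N = n + e₀`. -/
noncomputable def horoSymbol {N : ℕ} (f : CuspForm (Gamma0 N) 2) (p : ℕ) [Fact p.Prime]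
    (ϖ : ℚ) (n : ℕ) (s : ZMod (p ^ n)) : ℚ_[p] :=
  (ϖ : ℚ_[p]) * ∑ᶠ w : rootsOfUnity (torsionOrder p) ℤ_[p],
    ((ratPlusSymbol f (((horoPoint p n w s).val : ℚ) / (p : ℚ) ^ (n + cyclotomicExponent p)) : ℚ)
      : ℚ_[p])

/-- `HorocycleNonConstancy W p` ("the first non-congruence layer separates `p`-power horocycle
loops"): for some level, two points of the `p`-power horocycle carry plus modular symbols of `W`
(Néron-normalised, Teichmüller-averaged) whose DIFFERENCE has norm `> p⁻¹`.  The difference of two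
same-level symbols is the `f`-period of an honest closed loop `{x/p^N, x'/p^N}` on `X₀(N_W)`, i.e.
the value of the character `κ = G_W mod p` of `H₁(X₀(N_W), ℤ)` on the loop class
`[γ_{x'} γ_x⁻¹]`, `γ_x ∈ Γ₀(N_W)` with right column `(x, p^N)ᵀ`. -/
def HorocycleNonConstancy (W : WeierstrassCurve ℚ) [W.IsElliptic] [W.IsGloballyMinimal]
    (p : ℕ) [Fact p.Prime] : Prop :=
  ∀ [NeZero (W.conductorNorm ℤ)] (f : CuspForm (Gamma0 (W.conductorNorm ℤ)) 2),
    IsNewformOf W f → ∀ (ϖ : ℚ), (ϖ : ℝ) * W.realPeriodRat = plusPeriod f →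
    ∃ (n : ℕ) (s s' : ZMod (p ^ n)),
      (p : ℝ) ^ (-(1 : ℤ)) < ‖horoSymbol f p ϖ n s - horoSymbol f p ϖ n s'‖

/-- First lemma (S-sized): horocycle non-constancy ⇒ a unit ball, by the level recursion
`G_N(s) - G_N(s') = α^N (M(s) - M(s')) + α⁻¹ (G_{N-1}(s̄) - G_{N-1}(s̄'))` (`|α| = 1`) and
induction down to level `0`. Needs only `norm_unitRoot`. -/
def UnitBallOfNonConstancy : Prop :=
  ∀ (W : WeierstrassCurve ℚ) [W.IsElliptic] [W.IsGloballyMinimal] (p : ℕ) [Fact p.Prime],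
    norm_unitRoot W p → HorocycleNonConstancy W p → UnitBall W p

/-- First lemma (M-sized, Mahler/Amice): a unit ball ⇒ some coefficient of `ϖ · L_p(f, α, T)` has
norm `> p⁻¹`, i.e. `X1.MuPart.AnalyticMuLE W p 0` (the indicator of a ball has `ℤ_p`-integral
Mahler coefficients, so `‖M⁰(ball)‖ ≤ sup_k ‖c_k‖`). Needs the measure package
(`msdMeasure_distribution`, `exists_norm_msdMeasure_le`, `tendsto_padicLRiemannSum`). -/
def AnalyticMuZeroOfUnitBall : Prop :=
  ∀ (W : WeierstrassCurve ℚ) [W.IsElliptic] [W.IsGloballyMinimal] (p : ℕ) [Fact p.Prime],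
    ClassX1 W p → UnitBall W p → X1.MuPart.AnalyticMuLE W p 0

/-- (HC) **Horocycle congruence criterion** at level `N` and prime `p` — the transfer `C⁺`.
A character `κ : Γ₀(N) → ℤ/p^e` killing every non-hyperbolic element (`|tr γ| ≤ 2`: parabolic,
elliptic, `±1`; so `κ` is a character of `H₁(X₀(N), ℤ)`, an unramified cyclic cover with split
cusps), EVEN under `γ ↦ εγε⁻¹`, `ε = diag(-1,1)` (a character of `H₁(X₀(N), ℤ)⁺`), which is
CONSTANT on every `p`-power horocycle `D_n = {γ : d(γ) = p^n}`, `n ≥ 1`, factors through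
`γ ↦ d(γ) mod N` (is of Shimura type, i.e. its kernel is a congruence subgroup).
Conjectural; uniform in the newform; implies `μ = μ-type depth` for every weight-2 eigenform of
level `N` at `p` (in particular `HorocycleNonConstancy` for every type-A member of level `N`). -/
def HorocycleCongruenceCriterion (N p : ℕ) : Prop :=
  ∀ (e : ℕ) (κ : Gamma0 N →* Multiplicative (ZMod (p ^ e))),
    (∀ γ : Gamma0 N, |((γ : SL(2, ℤ)) : Matrix (Fin 2) (Fin 2) ℤ).trace| ≤ 2 → κ γ = 1) →
    (∀ γ γ' : Gamma0 N,
        ((γ' : SL(2, ℤ)) : Matrix (Fin 2) (Fin 2) ℤ) 0 0 = ((γ : SL(2, ℤ)) : Matrix (Fin 2) (Fin 2) ℤ) 0 0 →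
        ((γ' : SL(2, ℤ)) : Matrix (Fin 2) (Fin 2) ℤ) 0 1 = -((γ : SL(2, ℤ)) : Matrix (Fin 2) (Fin 2) ℤ) 0 1 →
        ((γ' : SL(2, ℤ)) : Matrix (Fin 2) (Fin 2) ℤ) 1 0 = -((γ : SL(2, ℤ)) : Matrix (Fin 2) (Fin 2) ℤ) 1 0 →
        ((γ' : SL(2, ℤ)) : Matrix (Fin 2) (Fin 2) ℤ) 1 1 = ((γ : SL(2, ℤ)) : Matrix (Fin 2) (Fin 2) ℤ) 1 1 →
        κ γ' = κ γ) →
    (∀ n : ℕ, 0 < n → ∀ γ γ' : Gamma0 N,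
        ((γ : SL(2, ℤ)) : Matrix (Fin 2) (Fin 2) ℤ) 1 1 = (p : ℤ) ^ n →
        ((γ' : SL(2, ℤ)) : Matrix (Fin 2) (Fin 2) ℤ) 1 1 = (p : ℤ) ^ n → κ γ = κ γ') →
    ∃ χ : ZMod N → Multiplicative (ZMod (p ^ e)),
      ∀ γ : Gamma0 N, κ γ = χ ((((γ : SL(2, ℤ)) : Matrix (Fin 2) (Fin 2) ℤ) 1 1 : ℤ) : ZMod N)

/-- The bridge from (HC) to the type-A horocycle statement (L-sized; the `(♠)` dictionary:
Manin–Drinfeld integrality of `G_W` on `H₁ + ℤ{0,∞}`, `κ_{m+1} = G_int mod p^{m+1}` is a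
character of `H₁(X₀(N),ℤ)` that is NOT of Shimura type because `m` is the full `μ`-type depth of
the isogeny class (Stevens 1989 / Wuthrich 2014 Thm 16), and same-level symbol differences are
`κ_{m+1}`-values on `D_N`-quotients). -/
def NonConstancyOfCriterion : Prop :=
  ∀ (W : WeierstrassCurve ℚ) [W.IsElliptic] [W.IsGloballyMinimal] (p : ℕ) [Fact p.Prime],
    ClassX1 W p → W.analyticRank = 0 → ¬ HasRamifiedOddLineAt W p →
    HorocycleCongruenceCriterion (W.conductorNorm ℤ) p → HorocycleNonConstancy W p

/-- Composition to the crux BY NAME through the landed μ/λ door: the horocycle statement discharges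
exactly the `hμ` half; the λ-count half `hlc` is untouched (other seats). -/
theorem mazurMCOnX1RankZero_of_horocycleNonConstancy
    (hP : EisensteinPrimes.PublishedInputs) (hW16 : Wuthrich2014.charIdeal_dvd_padicLFunction)
    (hunit : ∀ (W₀ : WeierstrassCurve ℚ) [W₀.IsElliptic] [W₀.IsGloballyMinimal] (p : ℕ)
      [Fact p.Prime], ClassX1 W₀ p → norm_unitRoot W₀ p)
    (hS : UnitBallOfNonConstancy) (hM : AnalyticMuZeroOfUnitBall)
    (hH : ∀ (W₀ : WeierstrassCurve ℚ) [W₀.IsElliptic] [W₀.IsGloballyMinimal] (p : ℕ) [Fact p.Prime],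
      ClassX1 W₀ p → W₀.analyticRank = 0 → ¬ HasRamifiedOddLineAt W₀ p →
        HorocycleNonConstancy W₀ p)
    (hlc : ∀ (W₀ : WeierstrassCurve ℚ) [W₀.IsElliptic] [W₀.IsGloballyMinimal] (p : ℕ) [Fact p.Prime],
      ClassX1 W₀ p → W₀.analyticRank = 0 → ¬ HasRamifiedOddLineAt W₀ p →
        ∃ n k : ℕ, X1.ParitySqueeze.AnalyticLambdaEq W₀ p n ∧
          X1.TamagawaSqueeze.AlgebraicLambdaGE W₀ p k ∧ n ≤ k) :
    EisensteinPrimes.MazurMCOnX1RankZero :=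
  EisensteinPrimesMazurMCOnX1RankZeroMudescent.mazurMCOnX1RankZero_of_analyticMuZero_offLocus_of_lambdaCount_offLocus
    hP hW16
    (fun W₀ _ _ p _ hX1 hr0 hoff ↦
      hM W₀ p hX1 (hS W₀ p (hunit W₀ p hX1) (hH W₀ p hX1 hr0 hoff)))
    hlc

/-- Same composition, with the group-theoretic transfer (HC) as the load-bearing input. -/
theorem mazurMCOnX1RankZero_of_horocycleCongruenceCriterion
    (hP : EisensteinPrimes.PublishedInputs) (hW16 : Wuthrich2014.charIdeal_dvd_padicLFunction)
    (hunit : ∀ (W₀ : WeierstrassCurve ℚ) [W₀.IsElliptic] [W₀.IsGloballyMinimal] (p : ℕ)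
      [Fact p.Prime], ClassX1 W₀ p → norm_unitRoot W₀ p)
    (hS : UnitBallOfNonConstancy) (hM : AnalyticMuZeroOfUnitBall) (hB : NonConstancyOfCriterion)
    (hHC : ∀ (W₀ : WeierstrassCurve ℚ) [W₀.IsElliptic] [W₀.IsGloballyMinimal] (p : ℕ)
      [Fact p.Prime], ClassX1 W₀ p → HorocycleCongruenceCriterion (W₀.conductorNorm ℤ) p)
    (hlc : ∀ (W₀ : WeierstrassCurve ℚ) [W₀.IsElliptic] [W₀.IsGloballyMinimal] (p : ℕ) [Fact p.Prime],
      ClassX1 W₀ p → W₀.analyticRank = 0 → ¬ HasRamifiedOddLineAt W₀ p →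
        ∃ n k : ℕ, X1.ParitySqueeze.AnalyticLambdaEq W₀ p n ∧
          X1.TamagawaSqueeze.AlgebraicLambdaGE W₀ p k ∧ n ≤ k) :
    EisensteinPrimes.MazurMCOnX1RankZero :=
  mazurMCOnX1RankZero_of_horocycleNonConstancy hP hW16 hunit hS hM
    (fun W₀ _ _ p _ hX1 hr0 hoff ↦ hB W₀ p hX1 hr0 hoff (hHC W₀ p hX1)) hlc

end Summit.BirchSwinnertonDyer.BirchSwinnertonDyer.Cruxes.MazurMCOnX1RankZero.HorocycleGeneration
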